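import Literature.MathematicalPhysics.QuantumFieldTheory.Balaban1983to89.B9Thm313WholeBlocksPairMB
import Literature.MathematicalPhysics.QuantumFieldTheory.Balaban1983to89.B9Thm313WholeBlocksPairMZ
import Literature.MathematicalPhysics.QuantumFieldTheory.Balaban1983to89.B9Thm312WholeHZ

/-!
# `Balaban1983to89.B9Thm313WholeBlocksPairMBZ` — [B9] Theorem 3.13 (p. 426): the (3.43)–(3.45) Hölder block of the knit's row-21 PairMB leaf with the
# COARSE-FIELD LETTERS RE-CLASSED (Z-twin of `B9Thm313WholeBlocksPairMB.GG_holder_pairMB`; R1-cls of the cell's located «C-LETTER-FLAT-AT-ONE»)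

T. Bałaban, *Propagators for lattice gauge theories in a background field*, Commun. Math. Phys. **99** (1985) 389–434
[`Balaban1985BackgroundPropagators`, "B9"]; [4] = T. Bałaban, *Propagators and renormalization transformations for lattice
gauge theories. II*, Commun. Math. Phys. **96** (1984) 223–250 [`Balaban1984PropagatorsII`].  statement-level skeleton of published
theorems with citation tags; proofs where landed; nothing here is a claim about the Yang–Mills mass gap.

THE POINT.  `GG_holder_pairMB` composes the two (3.43) probe majorants (`GG_probe43L∕R_of_letters`) and the (3.44)∕(3.45) family inputs
(`GG_input44∕45Family_of_lettersB`) of 𝔊; all four read the coarse-field letters in the flat class.  ★ `GG_holder_pairMBZ` is the same composition over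
the Z-versions (`B9Thm313WholeHolderZ`, `B9Thm313WholeDirInputBZ`): letters `Letters313Z ∕ Letters313DZ ∕ Letters313DMZ ∕ Letters313HZ` and the probe
letter `LettersHHZ … (weightNorm (ofBlocks blkZ) wZ …) …` of `B9Thm312WholeHZ`; SAME conclusion and constants; proof verbatim (private constant
bookkeeping `polyI44_le_z ∕ polyI45_le_z ∕ constH313_mono_z` copied from the flat file).  `wZ ≡ 1` recovers the flat statement.

HONEST SCOPE.  Nothing of print is asserted: every analytic input is a HYPOTHESIS of printed ∕ md shape; kernel-checked bookkeeping.  NOT a node discharge,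
NOT summit progress; one finite lattice at a time; nothing continuum, nothing about the mass gap.  Cell `pub-ymgap` (HUMAN RULING D-0062), Track A node
N06 [B9], N06-ASSIGNMENT v1 row 21 (bundle F7), seat `pub-ymgap-dag-n06-l` (g14), 2026-08-27.  NEW file; nothing landed is modified.
-/

namespace Literature.MathematicalPhysics.QuantumFieldTheory.Balaban1983to89.B9Thm313WholeBlocksPairMBZ

open Literature.MathematicalPhysics.QuantumFieldTheory.Balaban1983to89
open Finset B6RandomWalk B6RandomWalkHom B9Thm34Ext B9Thm37GlueCor36 B11SectG B9SectDSup B9Thm37AllNorms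
open B9Thm37AllNormsInstances B9FromB6 B9SectBStepWhole B9Thm312Whole B9Thm312WholeLeaf B9Thm312WholeLeft B9Thm313Whole B9Thm313WholeLeft
open B9Thm37Glue B9SectDL2Decay B9RWSums343Holder B9RWSumsReadsRel B9RWSumsReadsNbr B9Ineq347 B9Thm312WholeClasses B9Thm312WholeL2
open B9Thm312WholeBlocksRel B9Thm312WholeBlocksNbr B9Thm312WholeHolder B9Thm312WholeHHolder B9Thm313WholeHolder B9Thm313WholeL2G B9Thm313WholeL2GP B9Thm313WholeInput
open B9RWSums346SecondDiff B9Thm313WholeBlocksNbr B9Thm312WholeBlocksNbrRec B9Thm313WholeBlocksNbrRec B9RWSums344InputFam B9Thm312WholeDir B9Thm312WholeBlocksPairM B9Thm313WholeDir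
open B9Thm313WholeDirInput B9Thm313WholeBlocksPairM B9Thm312WholeDirB B9Thm313WholeDirInputB B9Thm313WholeBlocksPairMB B9Thm313WholeBlocksPairMZ B9Thm312WholeHZ B9Thm313WholeZ
open B9Thm313WholeLeftZ B9Thm313WholeHolderZ B9Thm313WholeInputZ B9Thm313WholeDirZ B9Thm313WholeDirInputZ B9Thm313WholeDirInputBZ B9Thm313WholeL2GZ B9Thm313WholeL2GPZ
open B9Thm313WholeDirL2Z

noncomputable section

section OneMember

variable {g : B9.Geometry} {B : B9.Backgrounds} {X Y Z W PX PY P : Type}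
variable [Fintype X] [Fintype Y] [Fintype Z] [Fintype W] [Fintype PX] [Fintype PY] [Fintype P] [Fintype g.Site] [DecidableEq g.Site]
variable {R₀ : ℝ} {H₀ : Prop}

omit [Fintype X] [Fintype Y] [Fintype Z] [Fintype W] [Fintype PX] [Fintype PY] [Fintype P] [Fintype g.Site] [DecidableEq g.Site] in
/-- the polynomial of `constI44` is monotone in (A₁, A₃, θ′, θ_H, θ_v, Λ, κ) for non-negative data (verbatim the sibling's private lemma).
[cite: Balaban1985BackgroundPropagators, Thm 3.13 p.426 (bookkeeping)] -/
private theorem polyI44_le_z {Bi Bd B₀ B₃ Br c A₁ A₁' A₃ A₃' t' T' tH TH tv TV Λ Λ' κ κ' : ℝ} (hBd : 0 ≤ Bd) (hB₀ : 0 ≤ B₀)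
    (hB₃ : 0 ≤ B₃) (hBr : 0 ≤ Br) (hc : 0 ≤ c) (hA₁ : 0 ≤ A₁) (hA₁' : A₁ ≤ A₁') (hA₃ : 0 ≤ A₃) (hA₃' : A₃ ≤ A₃') (ht' : 0 ≤ t')
    (hT' : t' ≤ T') (htH : 0 ≤ tH) (hTH : tH ≤ TH) (htv : 0 ≤ tv) (hTV : tv ≤ TV) (hΛ : 0 ≤ Λ) (hΛ' : Λ ≤ Λ') (hκ : 0 ≤ κ)
    (hκ' : κ ≤ κ') :
    (Bi + (B₀ + t' * A₁ * c) * Λ * tH * c) + κ * (Bd + (B₀ + t' * A₁ * c) * Λ * tv * c) * Br * c +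
        (B₃ + t' * A₃ * c) * Λ * (B₃ * (B₃ * A₁ * c) * c) * c ≤
      (Bi + (B₀ + T' * A₁' * c) * Λ' * TH * c) + κ' * (Bd + (B₀ + T' * A₁' * c) * Λ' * TV * c) * Br * c +
        (B₃ + T' * A₃' * c) * Λ' * (B₃ * (B₃ * A₁' * c) * c) * c := by
  have hA₁'0 : 0 ≤ A₁' := hA₁.trans hA₁'
  have hA₃'0 : 0 ≤ A₃' := hA₃.trans hA₃'
  have hT'0 : 0 ≤ T' := ht'.trans hT'
  have hTH0 : 0 ≤ TH := htH.trans hTH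
  have hTV0 : 0 ≤ TV := htv.trans hTV
  have hΛ'0 : 0 ≤ Λ' := hΛ.trans hΛ'
  have hκ'0 : 0 ≤ κ' := hκ.trans hκ'
  have h1 : (B₀ + t' * A₁ * c) * Λ * tH * c ≤ (B₀ + T' * A₁' * c) * Λ' * TH * c := by gcongr
  have h2 : κ * (Bd + (B₀ + t' * A₁ * c) * Λ * tv * c) * Br * c ≤ κ' * (Bd + (B₀ + T' * A₁' * c) * Λ' * TV * c) * Br * c := by
    gcongr
  have h3 : (B₃ + t' * A₃ * c) * Λ * (B₃ * (B₃ * A₁ * c) * c) * c ≤ (B₃ + T' * A₃' * c) * Λ' * (B₃ * (B₃ * A₁' * c) * c) * c := by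
    gcongr
  linarith

omit [Fintype X] [Fintype Y] [Fintype Z] [Fintype W] [Fintype PX] [Fintype PY] [Fintype P] [Fintype g.Site] [DecidableEq g.Site] in
/-- the polynomial of `constI45` is monotone in (A₁, A₃, θ_H, θ_v, Λ, κ) for non-negative data (verbatim the sibling's private lemma).
[cite: Balaban1985BackgroundPropagators, Thm 3.13 p.426 (bookkeeping)] -/
private theorem polyI45_le_z {Bi2 Bd2 Bh Bq B₀ B₃ Br c A₁ A₁' A₃ A₃' tH TH tv TV Λ Λ' κ κ' : ℝ} (hBd2 : 0 ≤ Bd2) (hBh : 0 ≤ Bh)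
    (hBq : 0 ≤ Bq) (hB₃ : 0 ≤ B₃) (hBr : 0 ≤ Br) (hc : 0 ≤ c) (hA₁ : 0 ≤ A₁) (hA₁' : A₁ ≤ A₁') (hA₃ : 0 ≤ A₃) (hA₃' : A₃ ≤ A₃')
    (htH : 0 ≤ tH) (hTH : tH ≤ TH) (htv : 0 ≤ tv) (hTV : tv ≤ TV) (hΛ : 0 ≤ Λ) (hΛ' : Λ ≤ Λ') (hκ : 0 ≤ κ) (hκ' : κ ≤ κ')
    (_hB₀ : 0 ≤ B₀) :
    (Bi2 + (Bh + tH * A₁ * c) * Λ * tH * c) + κ * (Bd2 + (Bh + tH * A₁ * c) * Λ * tv * c) * Br * c +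
        (Bq + tH * A₃ * c) * Λ * (B₃ * (B₃ * A₁ * c) * c) * c ≤
      (Bi2 + (Bh + TH * A₁' * c) * Λ' * TH * c) + κ' * (Bd2 + (Bh + TH * A₁' * c) * Λ' * TV * c) * Br * c +
        (Bq + TH * A₃' * c) * Λ' * (B₃ * (B₃ * A₁' * c) * c) * c := by
  have hA₁'0 : 0 ≤ A₁' := hA₁.trans hA₁'
  have hA₃'0 : 0 ≤ A₃' := hA₃.trans hA₃'
  have hTH0 : 0 ≤ TH := htH.trans hTH
  have hTV0 : 0 ≤ TV := htv.trans hTV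
  have hΛ'0 : 0 ≤ Λ' := hΛ.trans hΛ'
  have hκ'0 : 0 ≤ κ' := hκ.trans hκ'
  have h1 : (Bh + tH * A₁ * c) * Λ * tH * c ≤ (Bh + TH * A₁' * c) * Λ' * TH * c := by gcongr
  have h2 : κ * (Bd2 + (Bh + tH * A₁ * c) * Λ * tv * c) * Br * c ≤ κ' * (Bd2 + (Bh + TH * A₁' * c) * Λ' * TV * c) * Br * c := by
    gcongr
  have h3 : (Bq + tH * A₃ * c) * Λ * (B₃ * (B₃ * A₁ * c) * c) * c ≤ (Bq + TH * A₃' * c) * Λ' * (B₃ * (B₃ * A₁' * c) * c) * c := by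
    gcongr
  linarith

omit [Fintype X] [Fintype Y] [Fintype Z] [Fintype W] [Fintype PX] [Fintype PY] [Fintype P] [Fintype g.Site] [DecidableEq g.Site] in
/-- `constH313` is monotone in every constant but B₃, c (for non-negative data) (verbatim the sibling's private lemma).
[cite: Balaban1985BackgroundPropagators, Thm 3.13 p.426 (bookkeeping)] -/
private theorem constH313_mono_z {CL CL' θ' θ'' A₁ A₁' A₃ A₃' B₃ Bd Bd' Bq Bq' κW κW' c : ℝ} (hL' : CL ≤ CL') (hθ : 0 ≤ θ')
    (hθ'' : θ' ≤ θ'') (h₁ : 0 ≤ A₁) (h₁' : A₁ ≤ A₁') (h₃ : 0 ≤ A₃) (h₃' : A₃ ≤ A₃') (hB : 0 ≤ B₃) (hd : 0 ≤ Bd) (hd' : Bd ≤ Bd')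
    (hq : 0 ≤ Bq) (hq' : Bq ≤ Bq') (hκ : 0 ≤ κW) (hκ' : κW ≤ κW') (hc : 0 ≤ c) :
    constH313 CL θ' A₁ A₃ B₃ Bd Bq κW c ≤ constH313 CL' θ'' A₁' A₃' B₃ Bd' Bq' κW' c := by
  unfold constH313
  have hθ''0 : 0 ≤ θ'' := hθ.trans hθ''
  have hA₃'0 : 0 ≤ A₃' := h₃.trans h₃'
  have hd'0 : 0 ≤ Bd' := hd.trans hd'
  have hκ'0 : 0 ≤ κW' := hκ.trans hκ'
  have hq'0 : 0 ≤ Bq' := hq.trans hq'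
  have e2 : κW * Bd * B₃ * c ≤ κW' * Bd' * B₃ * c := by gcongr
  have e3 : θ' * (A₃ * B₃ * c) * c ≤ θ'' * (A₃' * B₃ * c) * c := by gcongr
  have e4 : Bq * (B₃ * (B₃ * A₁ * c) * c) * c ≤ Bq' * (B₃ * (B₃ * A₁' * c) * c) * c := by gcongr
  have e5 : θ' * (A₃ * (B₃ * (B₃ * A₁ * c) * c) * c) * c ≤ θ'' * (A₃' * (B₃ * (B₃ * A₁' * c) * c) * c) * c := by gcongr
  linarith

-- heartbeat budget: as the sibling `GG_holder_pairM` (one-block proof in the 130–160k band on the farm).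
set_option maxHeartbeats 400000 in

/-- **Z-TWIN** of `B9Thm313WholeBlocksPairMB.GG_holder_pairMB` over `Letters313Z ∕ DZ ∕ DMZ ∕ HZ` and `B9Thm312WholeHZ.LettersHHZ` at the weighted
coarse class `Z_{wZ}` (one free weight); statement and proof otherwise VERBATIM. ★ **THEOREM 3.13 — THE HÖLDER BLOCK (3.43)–(3.45) OF 𝔊's KERNEL FAMILY ON THE PAIR FAMILY, β∕ε-INDEXED STEP ∕ LETTER CONSTANTS** (B-twin of `GG_holder_pairM`: `StepDirB`, `Letters313IMB`, uniformising letters t_H(β), t_I(ε), t_V(ε) pointwise, t_M = max(t_H β, t_I (β+ε)) in the (3.45) member; otherwise as the original: the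
twin of `…BlocksNbr.GG_holder_nbr` with the (3.44)∕(3.45) co-reading moved to `InputReadsFam … (blk ∘ Prod.fst) (blkPX ∘ Prod.fst) (fun β => sliceProbe (Φ^X_β U))
ev (familyOp (q ↦ ∇_{U,q.1} ∘ 𝔊 ∘ ∇\*_{U,q.2}))`).  (3.43) from the two probe majorants of (3.153) (`GG_probe43L∕R_of_letters`: Theorem 3.3's probes for G₀ —
`Thm33G0Dir.h43L∕h43R` —, the Hölder step `StepDir.pY1∕pX1`, the letters `LettersHH.pQ`, `Letters313H`, `Letters313D.rgdH`) read through `H1ReadsNbr`;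
(3.44)∕(3.45) from `GG_input44Family∕45Family_of_letters` (the direction-indexed schemas `Thm33G0Dir ∕ Thm33G0DirR ∕ StepDir` and letters `Letters313DM ∕
Letters313IM`) read through `InputReadsFam`; the member constants brought to the family-uniform expressions ((1 − θc)⁻¹ ≦ 2, θ_D′ ≦ t_D, θ_H′ ≦ t_H, θ_V′ ≦
t_V, Λ ≦ Λ_u, κ ≦ κ_u), then `B9Thm312WholeBlocksPairM.ineq343_345_of_majorants_pairM` at the rate ρ₄ (ρ₄ + 3σ ≦ (1 − α)ρ′).  Nothing of print asserted.
[cite: Balaban1985BackgroundPropagators, Thm 3.13 p.426 + (3.152)–(3.153) p.426 + (3.43)–(3.45) p.398 + (3.39)–(3.40) p.397 + Thm 3.12 p.423; Balaban1984PropagatorsII, (2.51)–(2.52) p.232 + Lemma 2.1 (2.60)–(2.61) p.234] -/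
theorem GG_holder_pairMBZ (hG : GeoOK g) (𝔭 : HolderProbes g B X Y PX PY) (K : B9.KernelFamily g B) {𝔬 : Ops g B X Y Z W} {U : B.Cfg}
    {Dd Dds : B.Cfg → P → Module.End ℝ (X → ℝ)}
    {bHX : ℝ → BlockNorm (toB6 g R₀ H₀) (X → ℝ)} {bHW : ℝ → BlockNorm (toB6 g R₀ H₀) (W → ℝ)} {bH : BlockNorm (toB6 g R₀ H₀) (W → ℝ)}
    (Rel : g.Site → g.Site → Prop) [DecidableRel Rel] {ev : g.Loc → X → ℝ} {evY : g.Loc → Y → ℝ} {m : ℕ}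
    {r CL θ θD' tD B₀ B₃ Λ Λu κu ρ ρ' ρ₄ α σ c δ₀ δ₃ δK : ℝ} {θH' θI' θv' tH tI tV Br Bh Bi Bq Bd BhD Bx : ℝ → ℝ} {Bi2 Bd2 : ℝ → ℝ → ℝ}
    (hrow : RowSum (toB6 g R₀ H₀) σ c) (hc : 0 ≤ c) (hθ : 0 ≤ θ) (hθD' : 0 ≤ θD') (hθH' : ∀ β, 0 ≤ β → β < 1 → 0 ≤ θH' β)
    (hθI' : ∀ ε, 0 < ε → 0 ≤ θI' ε) (hθv' : ∀ ε, 0 < ε → 0 ≤ θv' ε)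
    (hθD'le : θD' ≤ tD) (hθH'le : ∀ β, 0 ≤ β → β < 1 → θH' β ≤ tH β) (hθI'le : ∀ ε, 0 < ε → θI' ε ≤ tI ε)
    (hθv'le : ∀ ε, 0 < ε → θv' ε ≤ tV ε) (hB₀ : 0 ≤ B₀) (hB₃ : 0 ≤ B₃) (hBr : ∀ ε, 0 < ε → 0 ≤ Br ε) (hq : θ * c ≤ 1 / 2)
    (hBh : ∀ β, 0 ≤ β → β < 1 → 0 ≤ Bh β) (hBi : ∀ ε, 0 < ε → ε ≤ 1 → 0 ≤ Bi ε) (hBq : ∀ β, 0 ≤ β → β < 1 → 0 ≤ Bq β)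
    (hBd : ∀ ε, 0 < ε → ε ≤ 1 → 0 ≤ Bd ε) (hBi2 : ∀ ε β, 0 < ε → ε ≤ 1 → 0 ≤ β → β < 1 → 0 ≤ Bi2 ε β)
    (hBd2 : ∀ ε β, 0 < ε → ε ≤ 1 → 0 ≤ β → β < 1 → 0 ≤ Bd2 ε β) (hBhD : ∀ β, 0 ≤ β → β < 1 → 0 ≤ BhD β)
    (hBx : ∀ β, 0 ≤ β → β < 1 → 0 ≤ Bx β) (hΛ0 : 0 ≤ Λ) (hΛle : Λ ≤ Λu)
    (hκ : bH.κ ≤ κu) (hκW : ∀ ε, (bHW ε).κ ≤ κu) (h1κ : 1 ≤ κu) (hα0 : 0 ≤ α) (hσ : 0 ≤ σ) (hρ' : 0 < ρ') (hρ'ρ : ρ' + 3 * σ ≤ ρ)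
    (hρ₄0 : 0 ≤ ρ₄) (hρ₄r : ρ₄ + 3 * σ ≤ (1 - α) * ρ') (hρS : ρ ≤ δ₀) (hρ₃ : ρ ≤ δ₃) (hρδ : ρ + σ ≤ δK)
    (hρ'0 : ρ' ≤ δ₀) (hρ'₃ : ρ' ≤ δ₃) (hρ'K : ρ' + σ ≤ δK) (hST : ScaleTransfer g ρ' α Λ (fun y => g.len y ^ (1 : ℝ)))
    (he0 : HasMajorant (g := toB6 g R₀ H₀) 𝔬.blk (𝔬.G0 U) (fun a b => B₀ * g.len a ^ 2 * Real.exp (-(δ₀ * g.dist a b))))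
    (he2 : HasMajorantHom (g := toB6 g R₀ H₀) 𝔬.blkY 𝔬.blk (𝔬.G0 U ∘ₗ 𝔬.Dstar U)
      (fun (a b : g.Site) => B₀ * g.len a * Real.exp (-(δ₀ * g.dist a b))))
    (hK1 : HasMaj (cNorm R₀ H₀ 𝔬.blk hG.lenle 1) (cNorm R₀ H₀ 𝔬.blk hG.lenle 1) (𝔬.G0 U ∘ₗ (𝔬.Tpi U + 𝔬.T2 U))
      (fun a b => θ * Real.exp (-(δK * g.dist a b))))
    (hK2 : HasMaj (cNorm R₀ H₀ 𝔬.blk hG.lenle 2) (cNorm R₀ H₀ 𝔬.blk hG.lenle 2) (𝔬.G0 U ∘ₗ (𝔬.Tpi U + 𝔬.T2 U))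
      (fun a b => θ * Real.exp (-(δK * g.dist a b))))
    (hH0 : Thm33G0Dir 𝔬 𝔭 Dd Dds R₀ H₀ bHX B₀ Bh Bi Bi2 δ₀ U) (hHR : Thm33G0DirR 𝔬 Dds R₀ H₀ B₀ δ₀ U)
    (hStD : StepDirB 𝔬 𝔭 Dd Dds R₀ H₀ bHX hG.lenle θD' θH' θI' δK U) {wZ : g.Site → ℝ} {hwZ : ∀ y, 0 < wZ y}
    (hHH : LettersHHZ 𝔬 𝔭 R₀ H₀ hG.lenle (weightNorm (BlockNorm.ofBlocks (toB6 g R₀ H₀) 𝔬.blkZ) wZ fun y => (hwZ y).le) Bq δ₃ U)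
    (hH3 : Letters313HZ 𝔬 𝔭 R₀ H₀ hG wZ hwZ bH BhD Bx δ₃ U)
    (hL : Letters313Z 𝔬 R₀ H₀ hG wZ hwZ B₃ δ₃ U) (hLD : Letters313DZ 𝔬 R₀ H₀ hG wZ hwZ B₃ δ₃ bH U)
    (hLDM : Letters313DMZ 𝔬 𝔭 Dd R₀ H₀ hG wZ hwZ B₃ Bq δ₃ bH U)
    (hLIM : Letters313IMB 𝔬 𝔭 Dd Dds R₀ H₀ hG.lenle bHX bHW Br θv' Bd Bd2 δ₃ δK U) (hI : Identities 𝔬 U)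
    (hRd₂ : ∀ a b b', Rel b b' → g.dist a b = g.dist a b')
    (hmult : ∀ y' : g.Site, (Finset.univ.filter (fun y'' => Rel y'' y')).card ≤ m)
    (hCL1 : 1 ≤ CL) (hCL : ∀ a a' : g.Site, g.dist a a' ≤ r → g.len a ≤ CL * g.len a')
    (hH1 : H1ReadsNbr K U 𝔭 Rel r 𝔬.blk 𝔬.blkY ev evY (𝔬.D U ∘ₗ 𝔬.GG U) (𝔬.GG U ∘ₗ 𝔬.Dstar U))
    (hIn : InputReadsFam K U bHX r (𝔬.blk ∘ Prod.fst) (𝔭.blkPX ∘ Prod.fst) (fun β => sliceProbe (𝔭.ΦX U β)) ev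
      (familyOp (fun q : P × P => Dd U q.1 ∘ₗ (𝔬.GG U ∘ₗ Dds U q.2)))) :
    B9.Ineq343_345 K
      (fun β => m * CL * Real.exp (r * ρ₄) *
        constH313 (Bh β + tH β * (2 * B₀) * c) (tH β) (2 * B₀) (2 * B₃) B₃ (max (BhD β) (Bx β)) (max (Bq β) (Bx β)) κu c)
      (fun ε => Real.exp (r * ρ₄) * ((Bi ε + (B₀ + tD * (2 * B₀) * c) * Λu * tI ε * c) +
        κu * (Bd ε + (B₀ + tD * (2 * B₀) * c) * Λu * tV ε * c) * Br ε * c +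
        (B₃ + tD * (2 * B₃) * c) * Λu * (B₃ * (B₃ * (2 * B₀) * c) * c) * c))
      (fun ε β => CL * Real.exp (r * ρ₄) *
        ((Bi2 ε β + (Bh β + max (tH β) (tI (β + ε)) * (2 * B₀) * c) * Λu * max (tH β) (tI (β + ε)) * c) +
        κu * (Bd2 ε β + (Bh β + max (tH β) (tI (β + ε)) * (2 * B₀) * c) * Λu * tV (β + ε) * c) * Br (β + ε) * c +
        (Bq β + max (tH β) (tI (β + ε)) * (2 * B₃) * c) * Λu * (B₃ * (B₃ * (2 * B₀) * c) * c) * c)) ρ₄ U := by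
  -- adapted from `B9Thm313WholeBlocksNbr.GG_holder_nbr` ((3.44)∕(3.45) on the pair family)
  have hq1 : θ * c < 1 := lt_one_of_le_half hq
  have hinv0 : 0 ≤ (1 - θ * c)⁻¹ := inv_nonneg.mpr (by linarith)
  have hA₁ : 0 ≤ B₀ * (1 - θ * c)⁻¹ := mul_nonneg hB₀ hinv0
  have hA₃ : 0 ≤ B₃ * (1 - θ * c)⁻¹ := mul_nonneg hB₃ hinv0
  have hA₁le : B₀ * (1 - θ * c)⁻¹ ≤ 2 * B₀ := const_le_two_mul hB₀ hq
  have hA₃le : B₃ * (1 - θ * c)⁻¹ ≤ 2 * B₃ := const_le_two_mul hB₃ hq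
  have hκu0 : 0 ≤ κu := zero_le_one.trans h1κ
  have htD0 : 0 ≤ tD := hθD'.trans hθD'le
  have htH0 : ∀ β, 0 ≤ β → β < 1 → 0 ≤ tH β := fun β h0 h1 => (hθH' β h0 h1).trans (hθH'le β h0 h1)
  have htI0 : ∀ ε, 0 < ε → 0 ≤ tI ε := fun ε hε => (hθI' ε hε).trans (hθI'le ε hε)
  have htV0 : ∀ ε, 0 < ε → 0 ≤ tV ε := fun ε hε => (hθv' ε hε).trans (hθv'le ε hε)
  -- the common constant of the (3.45) member: probe step at β, input step at β + ε
  have hθM : ∀ ε β, 0 < ε → 0 ≤ β → β < 1 → 0 ≤ max (θH' β) (θI' (β + ε)) := fun ε β hε h0 h1 =>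
    le_max_of_le_left (hθH' β h0 h1)
  have hθMle : ∀ ε β, 0 < ε → 0 ≤ β → β < 1 → max (θH' β) (θI' (β + ε)) ≤ max (tH β) (tI (β + ε)) := fun ε β hε h0 h1 =>
    max_le_max (hθH'le β h0 h1) (hθI'le (β + ε) (by linarith))
  have htM0 : ∀ ε β, 0 < ε → 0 ≤ β → β < 1 → 0 ≤ max (tH β) (tI (β + ε)) := fun ε β hε h0 h1 =>
    (hθM ε β hε h0 h1).trans (hθMle ε β hε h0 h1)
  have hΛu0 : 0 ≤ Λu := hΛ0.trans hΛle
  have h2B₀ : 0 ≤ 2 * B₀ := mul_nonneg zero_le_two hB₀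
  have h2B₃ : 0 ≤ 2 * B₃ := mul_nonneg zero_le_two hB₃
  have hlen := hG.lenle
  have hρ₄ρ' : ρ₄ ≤ ρ' := by
    have h1 : (1 - α) * ρ' = ρ' - α * ρ' := by ring
    linarith [mul_nonneg hα0 hρ'.le]
  have hexp : ∀ a b : g.Site, Real.exp (-(ρ' * g.dist a b)) ≤ Real.exp (-(ρ₄ * g.dist a b)) := fun a b =>
    Real.exp_le_exp.mpr (neg_le_neg (mul_le_mul_of_nonneg_right hρ₄ρ' (hG.dnn a b)))
  -- the (3.43) constant, uniformised
  set Cu : ℝ → ℝ := fun β => constH313 (Bh β + tH β * (2 * B₀) * c) (tH β) (2 * B₀) (2 * B₃) B₃ (max (BhD β) (Bx β))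
    (max (Bq β) (Bx β)) κu c with hCu
  have hCuL : ∀ β, 0 ≤ β → β < 1 →
      constH313 (Bh β + θH' β * (B₀ * (1 - θ * c)⁻¹) * c) (θH' β) (B₀ * (1 - θ * c)⁻¹) (B₃ * (1 - θ * c)⁻¹) B₃ (BhD β) (Bq β) bH.κ c ≤
        Cu β := by
    intro β h0 h1
    have hCL' : Bh β + θH' β * (B₀ * (1 - θ * c)⁻¹) * c ≤ Bh β + tH β * (2 * B₀) * c := by
      have := mul_le_mul_of_nonneg_right (mul_le_mul (hθH'le β h0 h1) hA₁le hA₁ (htH0 β h0 h1)) hc; linarith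
    exact constH313_mono_z hCL' (hθH' β h0 h1) (hθH'le β h0 h1) hA₁ hA₁le hA₃ hA₃le hB₃ (hBhD β h0 h1) (le_max_left _ _) (hBq β h0 h1)
      (le_max_left _ _) bH.κ_nonneg hκ hc
  have hCuR : ∀ β, 0 ≤ β → β < 1 →
      constH313 (Bh β + θH' β * (B₀ * (1 - θ * c)⁻¹) * c) (θH' β) (B₀ * (1 - θ * c)⁻¹) (B₃ * (1 - θ * c)⁻¹) B₃ (Bx β) (Bx β) 1 c ≤
        Cu β := by
    intro β h0 h1
    have hCL' : Bh β + θH' β * (B₀ * (1 - θ * c)⁻¹) * c ≤ Bh β + tH β * (2 * B₀) * c := by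
      have := mul_le_mul_of_nonneg_right (mul_le_mul (hθH'le β h0 h1) hA₁le hA₁ (htH0 β h0 h1)) hc; linarith
    exact constH313_mono_z hCL' (hθH' β h0 h1) (hθH'le β h0 h1) hA₁ hA₁le hA₃ hA₃le hB₃ (hBx β h0 h1) (le_max_right _ _) (hBx β h0 h1)
      (le_max_right _ _) zero_le_one h1κ hc
  have hCu0 : ∀ β, 0 ≤ β → β < 1 → 0 ≤ Cu β := fun β h0 h1 =>
    (constH313_nonneg (add_nonneg (hBh β h0 h1) (mul_nonneg (mul_nonneg (hθH' β h0 h1) hA₁) hc)) (hθH' β h0 h1) hA₁ hA₃ hB₃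
      (hBx β h0 h1) (hBx β h0 h1) zero_le_one hc).trans (hCuR β h0 h1)
  -- the two (3.43) probe majorants of 𝔊, at the rate ρ₄ (one-slot, unchanged)
  have hL43 : ∀ β, 0 ≤ β → β < 1 → HasMajorantHom (g := toB6 g R₀ H₀) 𝔬.blk 𝔭.blkPY (𝔭.ΦY U β ∘ₗ (𝔬.D U ∘ₗ 𝔬.GG U))
      (fun (a b : g.Site) => Cu β * g.len a ^ (1 - β) * Real.exp (-(ρ₄ * g.dist a b))) := by
    intro β h0 h1
    have h := GG_probe43L_of_lettersZ hG 𝔭 hrow hc hθ (hθH' β h0 h1) hB₀ hB₃ (hBh β h0 h1) (hBq β h0 h1) (hBhD β h0 h1) hσ hρ'.le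
      hρ'ρ hρS hρ₃ hρδ hq1 hK2 he0 (hH0.h43L β h0 h1) (hStD.pY1 β h0 h1) (hHH.pQ β h0 h1) (hH3.pYDH β h0 h1) hL hLD.rgdH hI
    exact hasMajorantHom_mono (g := toB6 g R₀ H₀) 𝔬.blk 𝔭.blkPY h fun a b =>
      mul_le_mul (mul_le_mul_of_nonneg_right (hCuL β h0 h1) (Real.rpow_nonneg (hlen a) _)) (hexp a b) (Real.exp_nonneg _)
        (mul_nonneg (hCu0 β h0 h1) (Real.rpow_nonneg (hlen a) _))
  have hR43 : ∀ β, 0 ≤ β → β < 1 → HasMajorantHom (g := toB6 g R₀ H₀) 𝔬.blkY 𝔭.blkPX (𝔭.ΦX U β ∘ₗ (𝔬.GG U ∘ₗ 𝔬.Dstar U))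
      (fun (a b : g.Site) => Cu β * g.len a ^ (1 - β) * Real.exp (-(ρ₄ * g.dist a b))) := by
    intro β h0 h1
    have h := GG_probe43R_of_lettersZ hG 𝔭 hrow hc hθ (hθH' β h0 h1) hB₀ hB₃ (hBh β h0 h1) (hBx β h0 h1) hσ hρ'.le hρ'ρ hρS hρ₃ hρδ
      hq1 hK1 he2 (hH0.h43R β h0 h1) (hStD.pX1 β h0 h1) (hH3.pXDv β h0 h1) (hH3.pXQs β h0 h1) hL hI
    exact hasMajorantHom_mono (g := toB6 g R₀ H₀) 𝔬.blkY 𝔭.blkPX h fun a b =>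
      mul_le_mul (mul_le_mul_of_nonneg_right (hCuR β h0 h1) (Real.rpow_nonneg (hlen a) _)) (hexp a b) (Real.exp_nonneg _)
        (mul_nonneg (hCu0 β h0 h1) (Real.rpow_nonneg (hlen a) _))
  -- the (3.44), (3.45) input majorants of 𝔊 on the pair family at the rate ρ₄, constants uniformised
  have h44 : ∀ ε, 0 < ε → ε ≤ 1 → HasMaj (bHX ε) (BlockNorm.ofBlocks (toB6 g R₀ H₀) (𝔬.blk ∘ Prod.fst))
      (familyOp (fun q : P × P => Dd U q.1 ∘ₗ (𝔬.GG U ∘ₗ Dds U q.2)))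
      (fun (a b : g.Site) => ((Bi ε + (B₀ + tD * (2 * B₀) * c) * Λu * tI ε * c) +
        κu * (Bd ε + (B₀ + tD * (2 * B₀) * c) * Λu * tV ε * c) * Br ε * c +
        (B₃ + tD * (2 * B₃) * c) * Λu * (B₃ * (B₃ * (2 * B₀) * c) * c) * c) * Real.exp (-(ρ₄ * g.dist a b))) := by
    intro ε h0 h1
    have h := GG_input44Family_of_lettersBZ hG 𝔭 hrow hc hθ hθD' (hθI' ε h0) (hθv' ε h0) hB₀ hB₃ (hBi ε h0 h1) (hBd ε h0 h1) (hBr ε h0)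
      hΛ0 hα0 hσ h0 h1 hρ₄0 hρ₄r hρ'.le hρ'0 hρ'₃ hρ'K hq1 hST hK1 hK2 he0 hH0 hHR hStD hL hLDM hLIM hI
    refine h.mono fun a b => mul_le_mul_of_nonneg_right ?_ (Real.exp_nonneg _)
    unfold constI44
    exact polyI44_le_z (hBd ε h0 h1) hB₀ hB₃ (hBr ε h0) hc hA₁ hA₁le hA₃ hA₃le hθD' hθD'le (hθI' ε h0) (hθI'le ε h0) (hθv' ε h0)
      (hθv'le ε h0) hΛ0 hΛle (bHW ε).κ_nonneg (hκW ε)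
  have h45 : ∀ ε β, 0 < ε → ε ≤ 1 → 0 ≤ β → β < 1 →
      HasMaj (bHX (β + ε)) (BlockNorm.ofBlocks (toB6 g R₀ H₀) (𝔭.blkPX ∘ Prod.fst))
      (sliceProbe (𝔭.ΦX U β) ∘ₗ familyOp (fun q : P × P => Dd U q.1 ∘ₗ (𝔬.GG U ∘ₗ Dds U q.2)))
      (fun (a b : g.Site) => ((Bi2 ε β + (Bh β + max (tH β) (tI (β + ε)) * (2 * B₀) * c) * Λu * max (tH β) (tI (β + ε)) * c) +
        κu * (Bd2 ε β + (Bh β + max (tH β) (tI (β + ε)) * (2 * B₀) * c) * Λu * tV (β + ε) * c) * Br (β + ε) * c +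
        (Bq β + max (tH β) (tI (β + ε)) * (2 * B₃) * c) * Λu * (B₃ * (B₃ * (2 * B₀) * c) * c) * c) * g.len a ^ (-β) *
        Real.exp (-(ρ₄ * g.dist a b))) := by
    intro ε β h0 h1 hb0 hb1
    have hε' : 0 < β + ε := by linarith
    have h := GG_input45Family_of_lettersBZ hG 𝔭 hrow hc hθ (hθH' β hb0 hb1) (hθv' (β + ε) hε') hB₀ hB₃ (hBh β hb0 hb1)
      (hBi2 ε β h0 h1 hb0 hb1) (hBq β hb0 hb1) (hBd2 ε β h0 h1 hb0 hb1) (hBr (β + ε) hε') hΛ0 hα0 hσ h0 h1 hb0 hb1 hρ₄0 hρ₄r hρ'.le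
      hρ'0 hρ'₃ hρ'K hq1 hST hK1 hK2 he0 hH0 hHR hStD hL hLDM hLIM hI
    refine h.mono fun a b => mul_le_mul_of_nonneg_right (mul_le_mul_of_nonneg_right ?_ (Real.rpow_nonneg (hG.lenle a) _))
      (Real.exp_nonneg _)
    unfold constI45
    exact polyI45_le_z (hBd2 ε β h0 h1 hb0 hb1) (hBh β hb0 hb1) (hBq β hb0 hb1) hB₃ (hBr (β + ε) hε') hc hA₁ hA₁le hA₃ hA₃le
      (hθM ε β h0 hb0 hb1) (hθMle ε β h0 hb0 hb1) (hθv' (β + ε) hε') (hθv'le (β + ε) hε') hΛ0 hΛle (bHW (β + ε)).κ_nonneg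
      (hκW (β + ε)) hB₀
  have hU44 : ∀ ε, 0 < ε → ε ≤ 1 → 0 ≤ (Bi ε + (B₀ + tD * (2 * B₀) * c) * Λu * tI ε * c) +
      κu * (Bd ε + (B₀ + tD * (2 * B₀) * c) * Λu * tV ε * c) * Br ε * c +
      (B₃ + tD * (2 * B₃) * c) * Λu * (B₃ * (B₃ * (2 * B₀) * c) * c) * c := by
    intro ε h0 h1
    have hBiε := hBi ε h0 h1
    have hBdε := hBd ε h0 h1
    have htIε := htI0 ε h0
    have htVε := htV0 ε h0
    have hBrε := hBr ε h0
    positivity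
  have hU45 : ∀ ε β, 0 < ε → ε ≤ 1 → 0 ≤ β → β < 1 →
      0 ≤ (Bi2 ε β + (Bh β + max (tH β) (tI (β + ε)) * (2 * B₀) * c) * Λu * max (tH β) (tI (β + ε)) * c) +
      κu * (Bd2 ε β + (Bh β + max (tH β) (tI (β + ε)) * (2 * B₀) * c) * Λu * tV (β + ε) * c) * Br (β + ε) * c +
      (Bq β + max (tH β) (tI (β + ε)) * (2 * B₃) * c) * Λu * (B₃ * (B₃ * (2 * B₀) * c) * c) * c := by
    intro ε β h0 h1 hb0 hb1
    have hε' : 0 < β + ε := by linarith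
    have hBi2ε := hBi2 ε β h0 h1 hb0 hb1
    have hBd2ε := hBd2 ε β h0 h1 hb0 hb1
    have hBhβ := hBh β hb0 hb1
    have hBqβ := hBq β hb0 hb1
    have htM := htM0 ε β h0 hb0 hb1
    have htVε := htV0 (β + ε) hε'
    have hBrε := hBr (β + ε) hε'
    positivity
  exact ineq343_345_of_majorants_pairM (R := R₀) (H := H₀) hG 𝔭 bHX hRd₂ hmult hCL1 hCL hCu0 hU44 hU45 hρ₄0 hL43 hR43 h44 h45 hH1 hIn

end OneMember

end

end Literature.MathematicalPhysics.QuantumFieldTheory.Balaban1983to89.B9Thm313WholeBlocksPairMBZ
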